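import Summits.BirchSwinnertonDyer.Rank1Residual.F1Sign2.MinusHalfSumClosedFormProofs
import HarnessLib

/-!
# Cell `bsd-f1-sign2`, AN-33j PROOFS (§7): the gcd-partition `F_m = Σ_{d ∣ m} F×_d`, the divisor-count parity by involution, and `minusUnitHalfSumPureCycleLaw_holds` — KERNEL-CHECKED (-an g16, Sketch_v27/v28 §7; TURNKEY D-an-77 step 3)

TYPER FILING (cell `bsd-f1-sign2`, seat `-ty` g11; plan `MEMO-an-data/g16/turnkey/AN33k_PLAN.md` 7f0f7c3baffbdbe1 step 3): §7 of
`MEMO-an-data/g16/Sketch_v28.lean` d50ca18231cd831c (lines 800–1082; = §7 of `Sketch_v27.lean` 1f6effa7be7bca73, -an: farm rc 0 · 0 err · 0 warn ·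
0 sorry; REF1 §122: «AN-33b/c/j PROVED (kernel, std axioms); AN-33j data law 42 279/42 279») VERBATIM (one docstring added on
`exists_int_minusHalfSumUnits_eq_mul`), in the namespace of the statement file `F1Sign2/MinusHalfSumParityAtTwo.lean` (which declares
`minusHalfSumUnits` and AN-33j `MinusUnitHalfSumPureCycleLaw`, -ty g11 append) and importing the §6 sibling `F1Sign2/MinusHalfSumClosedFormProofs.lean`
(`minusHalfSum_closedForm_modTwo`).  Decls: `exists_int_minusHalfSumUnits_eq_mul`, the gcd-fibre identity `sum_filter_gcd_eq_minusHalfSumUnits`, the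
gcd-partition `minusHalfSum_eq_sum_divisors_minusHalfSumUnits` (`F_m = Σ_{d ∣ m} F×_d`), the divisor-count parity `card_filter_divisors_pure`
(`#{d ∣ m : d > 1, every prime factor a 3-cycle} ≡ [some 3-cycle prime ∣ m] (mod 2)` by the fixed-point-free involution `d ↦ d·p^{±1}`), the closed
form `minusHalfSumUnits_closedForm_modTwo` (strong induction on `m` through the partition), and **`minusUnitHalfSumPureCycleLaw_holds :
MinusUnitHalfSumPureCycleLaw`** (AN-33j) — a THEOREM; users' `(h : MinusUnitHalfSumPureCycleLaw)` binders are fed `_holds`.  Used by the sibling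
`F1Sign2/TwistedMinusSymbolSumProofs.lean` (§8, AN-33k/l/m).  Typer edits = this header, the imports, one docstring; proofs verbatim.
Placement REF2 v34 §1 (REF2_TXT_AN33j): «IN-PRINT-ASSEMBLY — the symbol-level special-value twin of Kriz–Li 2019 Thm 3.3/1.8 (seedless mod-2 congruence
along square-free 3-cycle twists of either sign); base case Δ < 0, rank 0 = Zhai 2016 Thm 1.1 + 1.6; mechanism Zhai 2016 Lemmas 2.2–2.3 / Cai–Li–Zhai
2020 Lemma 4.1 (parity of terms) / Mazur–Tate 1987 §1 norm relation; the Δ > 0 minus-side and rank-one sentences are unprinted (Zhai 2016 p. 3, Zhai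
2021 Rem. 1.4); NEW-COMBINATION-small; kernel-checked; beyond-print no.»  Nothing here proves BSD; 23715 not closed.
[cite: KrizLi2019, Thm 1.8, Thm 3.3] [cite: Zhai2016, Thm 1.1, Thm 1.6, Lemmas 2.2–2.3] [cite: CaiLiZhai2019, Lemma 4.1] [cite: MazurTate1987, §1]
-/

set_option autoImplicit false

noncomputable section

open scoped Classical MatrixGroups ModularForm

open CongruenceSubgroup Literature.NumberTheory.EllipticCurves Literature.NumberTheory.EllipticCurves.ModularForms

namespace Summit.BirchSwinnertonDyer.Rank1Residual.F1Sign2.ANg16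

/-! ### §7 PROOFS (v27): the gcd-partition `F_m = Σ_{d ∣ m} F×_d`, the divisor-count parity by involution, and AN-33j. -/

section UnitsSum

open Finset

variable {N : ℕ} (f : CuspForm (Gamma0 N) 2)

/-- The units-only half-sum `F×_m` is an integer multiple of any symbol unit `u`. -/
theorem exists_int_minusHalfSumUnits_eq_mul {u : ℚ} (hu : IsMinusSymbolUnit f u) (m : ℕ) :
    ∃ a : ℤ, minusHalfSumUnits f m = a * u :=
  exists_int_sum_ratMinusSymbol_eq_mul hu _ _

/-- The gcd-fibre of the half range: for `g ∣ m`, `m = g·d`, the `k ∈ [1,(m−1)/2]` with `gcd(k,m) = g` are the `g·k'` with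
`k' ∈ [1,(d−1)/2]`, `gcd(k',d) = 1`, and `[k/m]⁻ = [k'/d]⁻`. -/
theorem sum_filter_gcd_eq_minusHalfSumUnits {m g : ℕ} (hm : m ≠ 0) (hg : g ∣ m) :
    ∑ k ∈ (Icc 1 ((m - 1) / 2)).filter (fun k => Nat.gcd k m = g), ratMinusSymbol f ((k : ℚ) / (m : ℚ)) =
      minusHalfSumUnits f (m / g) := by
  obtain ⟨d, hd⟩ := hg
  have hg0 : 0 < g := Nat.pos_of_ne_zero (by rintro rfl; rw [zero_mul] at hd; exact hm hd)
  have hmd : m / g = d := by rw [hd, Nat.mul_div_cancel_left d hg0]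
  rw [hmd]
  unfold minusHalfSumUnits
  have hgQ : (g : ℚ) ≠ 0 := by exact_mod_cast hg0.ne'
  refine sum_nbij' (fun k => k / g) (fun k => g * k) ?_ ?_ ?_ ?_ ?_
  · intro k hk
    rw [mem_filter, mem_Icc] at hk
    rw [mem_filter, mem_Icc]
    obtain ⟨⟨hk1, hk2⟩, hkg⟩ := hk
    have hgk : g ∣ k := hkg ▸ Nat.gcd_dvd_left k m
    obtain ⟨k', hk'⟩ := hgk
    have hk'eq : k / g = k' := by rw [hk', Nat.mul_div_cancel_left k' hg0]
    rw [hk'eq]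
    refine ⟨⟨?_, ?_⟩, ?_⟩
    · rcases Nat.eq_zero_or_pos k' with h | h
      · rw [h, mul_zero] at hk'; omega
      · exact h
    · have h2 : g * (2 * k') < g * d := by
        calc g * (2 * k') = 2 * k := by rw [hk']; ring
          _ < m := by omega
          _ = g * d := hd
      have := Nat.lt_of_mul_lt_mul_left h2
      omega
    · have := Nat.gcd_div (Nat.gcd_dvd_left k m) (Nat.gcd_dvd_right k m)
      rw [hkg, Nat.div_self hg0, hk', hd, Nat.mul_div_cancel_left k' hg0, Nat.mul_div_cancel_left d hg0] at this
      exact this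
  · intro k' hk'
    rw [mem_filter, mem_Icc] at hk'
    rw [mem_filter, mem_Icc]
    obtain ⟨⟨h1, h2⟩, hcop⟩ := hk'
    refine ⟨⟨?_, ?_⟩, ?_⟩
    · exact Nat.mul_pos hg0 (by omega)
    · have h3 : g * (2 * k') ≤ g * (d - 1) := Nat.mul_le_mul_left g (by omega)
      have h4 : g * (d - 1) = g * d - g := Nat.mul_sub_one g d
      have h5 : 2 * (g * k') = g * (2 * k') := by ring
      rw [hd]
      omega
    · rw [hd, Nat.gcd_mul_left, Nat.Coprime.gcd_eq_one hcop, mul_one]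
  · intro k hk
    rw [mem_filter] at hk
    have hgk : g ∣ k := hk.2 ▸ Nat.gcd_dvd_left k m
    exact Nat.mul_div_cancel' hgk
  · intro k' _
    exact Nat.mul_div_cancel_left k' hg0
  · intro k hk
    rw [mem_filter] at hk
    have hgk : g ∣ k := hk.2 ▸ Nat.gcd_dvd_left k m
    obtain ⟨k', hk'⟩ := hgk
    simp only [hk', Nat.mul_div_cancel_left k' hg0, hd]
    push_cast
    rw [mul_div_mul_left _ _ hgQ]

/-- **`F_m = Σ_{d ∣ m} F×_d`** (partition of the half range by `gcd(k, m)`). -/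
theorem minusHalfSum_eq_sum_divisors_minusHalfSumUnits {m : ℕ} (hm : m ≠ 0) :
    minusHalfSum f m = ∑ d ∈ m.divisors, minusHalfSumUnits f d := by
  unfold minusHalfSum
  rw [← Nat.sum_div_divisors m (fun d => minusHalfSumUnits f d)]
  rw [← sum_fiberwise_of_maps_to (s := Icc 1 ((m - 1) / 2)) (t := m.divisors) (g := fun k => Nat.gcd k m)
    (fun k _ => Nat.mem_divisors.2 ⟨Nat.gcd_dvd_right k m, hm⟩)]
  refine sum_congr rfl fun g hg => ?_
  exact sum_filter_gcd_eq_minusHalfSumUnits f hm (Nat.mem_divisors.1 hg).1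

end UnitsSum

section UnitsClosedForm

open Finset

variable {N : ℕ} [NeZero N] (f : CuspForm (Gamma0 N) 2)

omit [NeZero N] in
/-- Parity count by a fixed-point-free involution `d ↦ d·p^{±1}`: for square-free `m` and a predicate `P` on primes, the number
of divisors `d > 1` of `m` all of whose prime factors satisfy `P` is odd iff some prime factor of `m` satisfies `P`. -/
theorem card_filter_divisors_pure {m : ℕ} (hsq : Squarefree m) (hm : m ≠ 0) (P : ℕ → Prop) [DecidablePred P] :
    ∃ j : ℕ, (m.divisors.filter (fun d => 1 < d ∧ ∀ q ∈ d.primeFactors, P q)).card =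
      2 * j + (if ∃ p ∈ m.primeFactors, P p then 1 else 0) := by
  by_cases hex : ∃ p ∈ m.primeFactors, P p
  · rw [if_pos hex]
    obtain ⟨p, hpm, hPp⟩ := hex
    have hp : p.Prime := Nat.prime_of_mem_primeFactors hpm
    have hpdm : p ∣ m := Nat.dvd_of_mem_primeFactors hpm
    set D₀ := m.divisors.filter (fun d => ∀ q ∈ d.primeFactors, P q) with hD₀
    have hmemD₀ : ∀ d, d ∈ D₀ ↔ d ∣ m ∧ ∀ q ∈ d.primeFactors, P q := by
      intro d; rw [hD₀, mem_filter, Nat.mem_divisors]; tauto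
    let σ : ℕ → ℕ := fun d => if p ∣ d then d / p else d * p
    have hσ : ∀ d ∈ D₀, σ d ∈ D₀ := by
      intro d hd
      rw [hmemD₀] at hd ⊢
      obtain ⟨hdm, hpure⟩ := hd
      have hd0 : d ≠ 0 := by rintro rfl; exact hm (Nat.eq_zero_of_zero_dvd hdm)
      simp only [σ]
      split_ifs with hpd
      · refine ⟨(Nat.div_dvd_of_dvd hpd).trans hdm, fun q hq => hpure q ?_⟩
        exact Nat.primeFactors_mono (Nat.div_dvd_of_dvd hpd) hd0 hq
      · refine ⟨Nat.Coprime.mul_dvd_of_dvd_of_dvd ((Nat.Prime.coprime_iff_not_dvd hp).2 hpd).symm hdm hpdm,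
          fun q hq => ?_⟩
        rw [Nat.primeFactors_mul hd0 hp.ne_zero, mem_union, hp.primeFactors, mem_singleton] at hq
        rcases hq with hq | rfl
        · exact hpure q hq
        · exact hPp
    have hσne : ∀ d ∈ D₀, σ d ≠ d := by
      intro d hd
      rw [hmemD₀] at hd
      have hd0 : 0 < d := Nat.pos_of_ne_zero (by rintro rfl; exact hm (Nat.eq_zero_of_zero_dvd hd.1))
      simp only [σ]
      split_ifs with hpd
      · exact (Nat.div_lt_self hd0 hp.one_lt).ne
      · exact (lt_mul_of_one_lt_right hd0 hp.one_lt).ne'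
    have hσσ : ∀ d ∈ D₀, σ (σ d) = d := by
      intro d hd
      rw [hmemD₀] at hd
      simp only [σ]
      by_cases hpd : p ∣ d
      · rw [if_pos hpd]
        have hnd : ¬ p ∣ d / p := by
          intro h
          have hpp : p * p ∣ d := by
            have := Nat.mul_dvd_mul_left p h
            rwa [Nat.mul_div_cancel' hpd] at this
          have := (hsq.squarefree_of_dvd hd.1) p hpp
          rw [Nat.isUnit_iff] at this
          exact hp.one_lt.ne' this
        rw [if_neg hnd, Nat.div_mul_cancel hpd]
      · rw [if_neg hpd, if_pos (Dvd.intro_left _ rfl), Nat.mul_div_cancel _ hp.pos]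
    have heven : ((D₀.card : ℕ) : ZMod 2) = 0 := by
      have h := Finset.sum_involution (s := D₀) (f := fun _ => (1 : ZMod 2)) (fun d _ => σ d)
        (fun d _ => by decide) (fun d hd _ => hσne d hd) (fun d hd => hσ d hd) (fun d hd => hσσ d hd)
      rw [sum_const, nsmul_eq_mul, mul_one] at h
      exact h
    rw [ZMod.natCast_eq_zero_iff] at heven
    obtain ⟨j, hj⟩ := heven
    have hsplit := Finset.card_filter_add_card_filter_not (s := D₀) (fun d => 1 < d)
    have h1 : (D₀.filter (fun d => ¬ 1 < d)) = {1} := by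
      ext d
      rw [mem_filter, hmemD₀, mem_singleton]
      constructor
      · rintro ⟨⟨hdm, _⟩, hd1⟩
        have : d ≠ 0 := by rintro rfl; exact hm (Nat.eq_zero_of_zero_dvd hdm)
        omega
      · rintro rfl
        exact ⟨⟨one_dvd m, fun q hq => by simp at hq⟩, by omega⟩
    rw [h1, card_singleton] at hsplit
    have hff : D₀.filter (fun d => 1 < d) = m.divisors.filter (fun d => 1 < d ∧ ∀ q ∈ d.primeFactors, P q) := by
      ext d
      simp only [hD₀, mem_filter]
      tauto
    have h1mem : 1 ∈ D₀ := (hmemD₀ 1).2 ⟨one_dvd m, fun q hq => by simp at hq⟩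
    have hpos : 0 < D₀.card := card_pos.2 ⟨1, h1mem⟩
    refine ⟨j - 1, ?_⟩
    rw [← hff]
    omega
  · rw [if_neg hex]
    refine ⟨0, ?_⟩
    rw [mul_zero, zero_add, card_eq_zero, filter_eq_empty_iff]
    rintro d hd ⟨hd1, hpure⟩
    rw [Nat.mem_divisors] at hd
    obtain ⟨q, hq, hqd⟩ := Nat.exists_prime_and_dvd hd1.ne'
    have hqdf : q ∈ d.primeFactors := Nat.mem_primeFactors.2 ⟨hq, hqd, by omega⟩
    exact hex ⟨q, Nat.primeFactors_mono hd.1 hm hqdf, hpure q hqdf⟩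

/-- **Closed form of the units-only half-sum mod `2u` (the composite-door symbol law, PROVED).**  Same setting as
`minusHalfSum_closedForm_modTwo`.  For every square-free odd `m` with all prime factors `q ∤ N`:
`F×_m ≡ F_{q₀} (mod 2u)` if `m > 1` and EVERY prime factor of `m` has `a_q` odd (a "pure `3`-cycle" level), and
`F×_m ≡ 0 (mod 2u)` otherwise.  (So the mod-2 value of every such twisted Birch–Manin half-sum of `f` is one bit `η_f` times
the indicator of "pure `3`-cycle".) -/
theorem minusHalfSumUnits_closedForm_modTwo (hf : IsNewform0 f) (hQ : coeffField f = ⊥) {u : ℚ}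
    (hu : IsMinusSymbolUnit f u) {q₀ : ℕ} (hq₀ : q₀.Prime) (hq₀o : Odd q₀) (hq₀N : ¬ q₀ ∣ N) {a₀ : ℤ}
    (ha₀ : cuspCoeff f q₀ = (a₀ : ℂ)) (ha₀o : Odd a₀) (a : ℕ → ℤ) (m : ℕ) (hsq : Squarefree m) (hmo : Odd m)
    (hpr : ∀ q ∈ m.primeFactors, ¬ q ∣ N ∧ cuspCoeff f q = (a q : ℂ)) :
    ((1 < m ∧ ∀ q ∈ m.primeFactors, Odd (a q)) →
        ∃ z : ℤ, minusHalfSumUnits f m = minusHalfSum f q₀ + 2 * z * u) ∧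
    (¬ (1 < m ∧ ∀ q ∈ m.primeFactors, Odd (a q)) → ∃ z : ℤ, minusHalfSumUnits f m = 2 * z * u) := by
  obtain ⟨y, hy⟩ := exists_int_minusHalfSum_eq_mul hu q₀
  induction m using Nat.strong_induction_on with
  | _ m ih =>
    by_cases hm1 : m = 1
    · subst hm1
      have h0 : minusHalfSumUnits f 1 = 0 := by simp [minusHalfSumUnits]
      exact ⟨fun ⟨h, _⟩ => absurd h (by decide), fun _ => ⟨0, by rw [h0]; ring⟩⟩
    have hm0 : m ≠ 0 := by rintro rfl; exact absurd hmo (by decide)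
    have hm1' : 1 < m := by omega
    -- (i) `F_m = F×_m + Σ_{proper divisors} F×_d`
    have hsum : minusHalfSum f m = minusHalfSumUnits f m + ∑ d ∈ m.properDivisors, minusHalfSumUnits f d := by
      rw [minusHalfSum_eq_sum_divisors_minusHalfSumUnits f hm0, ← Nat.cons_self_properDivisors hm0, sum_cons]
    -- (ii) termwise closed form on the proper divisors (induction hypothesis)
    have hterm : ∀ d ∈ m.properDivisors, ∃ z : ℤ, minusHalfSumUnits f d -
        (if (1 < d ∧ ∀ q ∈ d.primeFactors, Odd (a q)) then minusHalfSum f q₀ else 0) = 2 * z * u := by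
      intro d hd
      rw [Nat.mem_properDivisors] at hd
      obtain ⟨hdm, hdlt⟩ := hd
      have ihd := ih d hdlt (hsq.squarefree_of_dvd hdm) (hmo.of_dvd_nat hdm)
        (fun q hq => hpr q (Nat.primeFactors_mono hdm hm0 hq))
      by_cases hP : (1 < d ∧ ∀ q ∈ d.primeFactors, Odd (a q))
      · obtain ⟨z, hz⟩ := ihd.1 hP
        exact ⟨z, by rw [if_pos hP, hz]; ring⟩
      · obtain ⟨z, hz⟩ := ihd.2 hP
        exact ⟨z, by rw [if_neg hP, hz]; ring⟩
    obtain ⟨Z, hZ⟩ := exists_int_sum_sub_sum m.properDivisors (fun d => minusHalfSumUnits f d)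
      (fun d => if (1 < d ∧ ∀ q ∈ d.primeFactors, Odd (a q)) then minusHalfSum f q₀ else 0) hterm
    have hite : ∑ d ∈ m.properDivisors, (if (1 < d ∧ ∀ q ∈ d.primeFactors, Odd (a q)) then minusHalfSum f q₀ else 0)
        = ((m.properDivisors.filter (fun d => 1 < d ∧ ∀ q ∈ d.primeFactors, Odd (a q))).card : ℚ)
          * minusHalfSum f q₀ := by
      rw [← sum_filter, sum_const, nsmul_eq_mul]
    rw [hite] at hZ
    -- (iii) the divisor-count parity
    obtain ⟨j, hj⟩ := card_filter_divisors_pure hsq hm0 (fun q => Odd (a q))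
    have hcnt : (m.divisors.filter (fun d => 1 < d ∧ ∀ q ∈ d.primeFactors, Odd (a q))).card =
        (m.properDivisors.filter (fun d => 1 < d ∧ ∀ q ∈ d.primeFactors, Odd (a q))).card +
          (if (1 < m ∧ ∀ q ∈ m.primeFactors, Odd (a q)) then 1 else 0) := by
      rw [← Nat.cons_self_properDivisors hm0, filter_cons]
      split_ifs with h
      · rw [card_cons]
      · simp
    -- (iv) the closed form of `F_m`
    have hA := minusHalfSum_closedForm_modTwo f hf hQ hu hq₀ hq₀o hq₀N ha₀ ha₀o a m hsq hmo hpr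
    by_cases hall : ∀ q ∈ m.primeFactors, Odd (a q)
    · have hPm : (1 < m ∧ ∀ q ∈ m.primeFactors, Odd (a q)) := ⟨hm1', hall⟩
      have hE : ∃ p ∈ m.primeFactors, Odd (a p) := by
        obtain ⟨p, hp⟩ := Nat.nonempty_primeFactors.2 hm1'
        exact ⟨p, hp, hall p hp⟩
      rw [if_pos hE] at hj
      rw [if_pos hPm, hj] at hcnt
      have hPD : ((m.properDivisors.filter (fun d => 1 < d ∧ ∀ q ∈ d.primeFactors, Odd (a q))).card : ℚ)
          = 2 * (j : ℚ) := by
        have : (m.properDivisors.filter (fun d => 1 < d ∧ ∀ q ∈ d.primeFactors, Odd (a q))).card = 2 * j := by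
          omega
        exact_mod_cast this
      rw [hPD] at hZ
      obtain ⟨z, hz⟩ := hA.1 hE
      refine ⟨fun _ => ⟨z - j * y - Z, ?_⟩, fun hn => absurd hPm hn⟩
      push_cast
      linear_combination (-1 : ℚ) * hsum + hz - hZ - 2 * (j : ℚ) * hy
    · have hPm : ¬ (1 < m ∧ ∀ q ∈ m.primeFactors, Odd (a q)) := fun h => hall h.2
      rw [if_neg hPm, add_zero] at hcnt
      refine ⟨fun h => absurd h hPm, fun _ => ?_⟩
      by_cases hE : ∃ p ∈ m.primeFactors, Odd (a p)
      · rw [if_pos hE, hcnt] at hj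
        have hPD : ((m.properDivisors.filter (fun d => 1 < d ∧ ∀ q ∈ d.primeFactors, Odd (a q))).card : ℚ)
            = 2 * (j : ℚ) + 1 := by exact_mod_cast hj
        rw [hPD] at hZ
        obtain ⟨z, hz⟩ := hA.1 hE
        refine ⟨z - j * y - Z, ?_⟩
        push_cast
        linear_combination (-1 : ℚ) * hsum + hz - hZ - 2 * (j : ℚ) * hy
      · rw [if_neg hE, hcnt, add_zero] at hj
        have hPD : ((m.properDivisors.filter (fun d => 1 < d ∧ ∀ q ∈ d.primeFactors, Odd (a q))).card : ℚ)
            = 2 * (j : ℚ) := by exact_mod_cast hj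
        rw [hPD] at hZ
        have hev : ∀ q ∈ m.primeFactors, Even (a q) := by
          intro q hq
          rcases Int.even_or_odd (a q) with h | h
          · exact h
          · exact absurd ⟨q, hq, h⟩ hE
        obtain ⟨z, hz⟩ := hA.2 hev
        refine ⟨z - j * y - Z, ?_⟩
        push_cast
        linear_combination (-1 : ℚ) * hsum + hz - hZ - 2 * (j : ℚ) * hy

end UnitsClosedForm

/-- **AN-33j PROVED.** -/
theorem minusUnitHalfSumPureCycleLaw_holds : MinusUnitHalfSumPureCycleLaw := by
  intro N _ f hf hQ u hu q₀ a₀ hq₀ hq₀o hq₀N ha₀ ha₀o a m hsq hmo hpr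
  exact minusHalfSumUnits_closedForm_modTwo f hf hQ hu hq₀ hq₀o hq₀N ha₀ ha₀o a m hsq hmo hpr

end Summit.BirchSwinnertonDyer.Rank1Residual.F1Sign2.ANg16
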